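import Summits.FinalStateConjecture.FinalStateConjecture.Theorems.SoloInformedHoleCount

/-!
# SoloInformed — the covering clause of `HasExhaustiveCharts` certifies exactly the reach of the certified slabs

Soloist `solo-FinalStateConjecture-informed` (session 30, 2026-08-19). Kernel facts about clause (ii)
of the typed SETTLING clause `HasExhaustiveCharts` of the summit `FinalStateConjecture`
(companion to `SoloInformedHoleCount.lean`, `SoloInformedInteriorRays.lean`, `SoloInformedDust.lean`;
paper/EXHAUST.md). Only set algebra and the pointwise computation of `J⁻` are used.

Clause (ii) says: for every chart time `τ₁ > τ₀`,
`O ∖ certifiedLate d R τ₁ ⊆ J⁻(certifiedSlab d R τ₁)`. What it forces depends ONLY on how far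
into the future the certified slab `certifiedSlab d R τ₁` reaches:

1. **Bounded reach ⇒ eventual certification** (`inter_subset_certifiedLate`,
   `HasExhaustiveCharts.exists_eventually_certified`). If `f` is any function that does not
   decrease along the causal relation (`p ∈ J⁻(q) → f p ≤ f q`; e.g. a time function of a globally
   hyperbolic development) and the certified slab at `τ₁` lies in `{f ≤ T}`, then EVERY event of `O`
   with `f > T` is certified-late at `τ₁`: it lies in the flat chart's late image or in some hole
   chart's near zone `{t*ᵢ > τ₁, rᵢ ≤ Rᵢ(t*ᵢ)}`. This is the positive content of the human ruling F2
   behind the clause ("no annulus between a near zone and the radiation zone, no late part of `O`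
   left uncertified"): it holds precisely when the certified slabs have bounded reach.
2. **Cofinal reach ⇒ the clause is free** (`hasExhaustiveCharts_of_subset_causalPast`,
   `hasExhaustiveCharts_of_flat_subslab`). If, for every `τ₁ > τ₀`, some part `B τ₁` of the flat slab
   `{x⁰ = τ₁} ∩ U₀` has a chart image whose causal past contains all of `O`, then clause (ii) holds
   with NOTHING required of the certified late regions. `SoloInformedDust.lean` shows that the typed
   flat domain `U₀ : Opens E4` (bounded below only, `setOf_lt_excision_subset_flatDomain`) has room, at
   every label, for a cofinal family of extra compact components inside the excision tubes ("dust");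
   mapping them by normal coordinates to a sequence of events running to timelike infinity in the
   domain of outer communications realises the hypothesis of item 2 on the intended strata
   (paper/CAPS.md §9, paper/EXHAUST.md §2: on the Schwarzschild exterior the causal future of any
   exterior event contains every sufficiently late event `(t_k, r_k = √t_k)`).

So, as typed, clause (ii) is equivalent to its F2 reading exactly for witnesses whose certified
slabs have bounded reach (item 1), and is vacuous for witnesses with dust (item 2); the slab-wise
repair F-m.1′ of paper/CAPS.md §9.4 (compact closure of the union of the non-mandated slab
components' images, per label) restores bounded reach.

References: [DafermosLuk2017] M. Dafermos, J. Luk, arXiv:1710.01722, Conjecture 1 (b)–(c);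
O'Neill 1983, Ch. 14, pp. 402–403 (`J⁺` pointwise); Hawking–Ellis 1973, §6.4 (time functions).
-/

open Literature.Geometry.Lorentzian
open scoped Manifold ContDiff Topology
open Filter Set

set_option linter.dupNamespace false

namespace Summit.FinalStateConjecture.FinalStateConjecture.Theorems

section Reach

variable {𝓢 : Spacetime.{0} 4} {O : Set 𝓢.carrier} {k : ℕ}

/-- **A causally non-decreasing function bounds causal pasts.** If `f p ≤ f q` whenever
`p ∈ J⁻(q)`, and `S ⊆ {f ≤ T}`, then `J⁻(S) ⊆ {f ≤ T}` (`J⁻` is computed pointwise).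
O'Neill 1983, Ch. 14, pp. 402–403. [cite: ONeill1983, Ch. 14  pp. 402–403] -/
theorem causalPast_subset_of_monotone (f : 𝓢.carrier → ℝ)
    (hmono : ∀ q p, p ∈ 𝓢.metric.causalPast 𝓢.timeOrientation {q} → f p ≤ f q)
    {S : Set 𝓢.carrier} {T : ℝ} (hS : S ⊆ {p | f p ≤ T}) :
    𝓢.metric.causalPast 𝓢.timeOrientation S ⊆ {p | f p ≤ T} := by
  intro p hp
  have hp' : p ∈ ⋃ q ∈ S, 𝓢.metric.causalPast 𝓢.timeOrientation {q} := by
    unfold LorentzianMetric.causalPast at hp ⊢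
    rwa [← LorentzianMetric.causalFuture_eq_biUnion]
  obtain ⟨q, hq, hpq⟩ := mem_iUnion₂.1 hp'
  exact (hmono q p hpq).trans (hS hq)

/-- **Bounded reach ⇒ eventual certification (clause (ii) at one chart time).** If clause (ii) of
`HasExhaustiveCharts` holds at `τ₁` for the radii `R`, `f` does not decrease along the causal
relation, and the certified slab at `τ₁` lies in `{f ≤ T}`, then every event of `O` with `f > T` is
certified-late at `τ₁` (in the flat chart's late image or in a hole chart's near zone after `τ₁`).
[cite: DafermosLuk2017, Conjecture 1 (b)–(c)] -/
theorem inter_subset_certifiedLate (d : FinalStateDecomposition 𝓢 O k) (R : Fin d.N → ℝ → ℝ)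
    {τ₁ : ℝ}
    (hii : O \ Summit.FinalStateConjecture.certifiedLate d R τ₁ ⊆
      𝓢.metric.causalPast 𝓢.timeOrientation (Summit.FinalStateConjecture.certifiedSlab d R τ₁))
    (f : 𝓢.carrier → ℝ)
    (hmono : ∀ q p, p ∈ 𝓢.metric.causalPast 𝓢.timeOrientation {q} → f p ≤ f q) {T : ℝ}
    (hslab : Summit.FinalStateConjecture.certifiedSlab d R τ₁ ⊆ {p | f p ≤ T}) :
    O ∩ {p | T < f p} ⊆ Summit.FinalStateConjecture.certifiedLate d R τ₁ := by
  rintro p ⟨hpO, hpT⟩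
  by_contra hpl
  have hle : f p ≤ T := causalPast_subset_of_monotone f hmono hslab (hii ⟨hpO, hpl⟩)
  exact absurd hle (not_le.2 hpT)

/-- **An uncertified event of `O` is not later than the certified slab.** Contrapositive form of
`inter_subset_certifiedLate`: under clause (ii) at `τ₁`, an event of `O` outside the certified late
region after `τ₁` has `f`-value at most any causal bound `T` of the certified slab at `τ₁`.
[cite: DafermosLuk2017, Conjecture 1 (b)–(c)] -/
theorem le_of_not_mem_certifiedLate (d : FinalStateDecomposition 𝓢 O k) (R : Fin d.N → ℝ → ℝ)
    {τ₁ : ℝ}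
    (hii : O \ Summit.FinalStateConjecture.certifiedLate d R τ₁ ⊆
      𝓢.metric.causalPast 𝓢.timeOrientation (Summit.FinalStateConjecture.certifiedSlab d R τ₁))
    (f : 𝓢.carrier → ℝ)
    (hmono : ∀ q p, p ∈ 𝓢.metric.causalPast 𝓢.timeOrientation {q} → f p ≤ f q) {T : ℝ}
    (hslab : Summit.FinalStateConjecture.certifiedSlab d R τ₁ ⊆ {p | f p ≤ T}) {p : 𝓢.carrier}
    (hpO : p ∈ O) (hpl : p ∉ Summit.FinalStateConjecture.certifiedLate d R τ₁) : f p ≤ T :=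
  causalPast_subset_of_monotone f hmono hslab (hii ⟨hpO, hpl⟩)

/-- **No annulus, in chart terms.** Under clause (ii) at `τ₁` with the certified slab at `τ₁` in
`{f ≤ T}`: an event of `O` with `f > T` outside the flat chart's late image `flatLate d τ₁` lies in
some hole chart's NEAR ZONE after `τ₁` — `p = chartᵢ x` with `t*ᵢ(x) > τ₁` and
`rᵢ(x) ≤ Rᵢ(t*ᵢ(x))`; in particular it is not in an uncertified annulus `Rᵢ < rᵢ` of a hole chart
unless that annulus is itself covered by the flat chart's late image. This is the audit-g6 reading
"no annulus between a near zone and the radiation zone", valid exactly under bounded reach.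
[cite: DafermosLuk2017, Conjecture 1 (b)–(c)] -/
theorem exists_mem_nearZone (d : FinalStateDecomposition 𝓢 O k) (R : Fin d.N → ℝ → ℝ)
    {τ₁ : ℝ}
    (hii : O \ Summit.FinalStateConjecture.certifiedLate d R τ₁ ⊆
      𝓢.metric.causalPast 𝓢.timeOrientation (Summit.FinalStateConjecture.certifiedSlab d R τ₁))
    (f : 𝓢.carrier → ℝ)
    (hmono : ∀ q p, p ∈ 𝓢.metric.causalPast 𝓢.timeOrientation {q} → f p ≤ f q) {T : ℝ}
    (hslab : Summit.FinalStateConjecture.certifiedSlab d R τ₁ ⊆ {p | f p ≤ T}) {p : 𝓢.carrier}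
    (hpO : p ∈ O) (hpT : T < f p) (hpf : p ∉ flatLate d τ₁) :
    ∃ (i : Fin d.N) (x : (d.background i).domain),
      τ₁ < (d.background i).time x.1 ∧
        (d.background i).radius x.1 ≤ R i ((d.background i).time x.1) ∧ d.chart i x = p := by
  rcases inter_subset_certifiedLate d R hii f hmono hslab ⟨hpO, hpT⟩ with h | h
  · exact absurd h hpf
  · obtain ⟨i, hi⟩ := mem_iUnion.1 h
    obtain ⟨x, hx, hxp⟩ := hi
    exact ⟨i, x, hx.1, hx.2, hxp⟩

/-- **Bounded reach ⇒ eventual certification (packaged).** For a typed decomposition with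
exhaustive charts and any causally non-decreasing `f`: there are near-zone radii `Rᵢ → ∞` (the
witness's) such that, for every chart time `τ₁ > τ₀` and every causal bound `T` of the certified slab
at `τ₁`, all of `O ∩ {f > T}` is certified-late at `τ₁`. With `f` a time function and the certified
slabs of bounded reach (`T = T(τ₁) < ∞`), this is the F2 reading of the clause: no late part of `O`
is left uncertified. [cite: DafermosLuk2017, Conjecture 1 (b)–(c)] -/
theorem HasExhaustiveCharts.exists_eventually_certified (d : FinalStateDecomposition 𝓢 O k)
    (hex : Summit.FinalStateConjecture.HasExhaustiveCharts d) (f : 𝓢.carrier → ℝ)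
    (hmono : ∀ q p, p ∈ 𝓢.metric.causalPast 𝓢.timeOrientation {q} → f p ≤ f q) :
    ∃ R : Fin d.N → ℝ → ℝ, (∀ i, Tendsto (R i) atTop atTop) ∧
      ∀ τ₁ : ℝ, d.τ₀ < τ₁ → ∀ T : ℝ,
        Summit.FinalStateConjecture.certifiedSlab d R τ₁ ⊆ {p | f p ≤ T} →
          O ∩ {p | T < f p} ⊆ Summit.FinalStateConjecture.certifiedLate d R τ₁ := by
  obtain ⟨R, hR, -, hii⟩ := hex
  exact ⟨R, fun i ↦ (hR i).1, fun τ₁ hτ T hslab ↦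
    inter_subset_certifiedLate d R (hii τ₁ hτ) f hmono hslab⟩

/-- **Cofinal reach ⇒ clause (ii) is free.** If for every chart time `τ₁ > τ₀` the whole of `O`
lies in the causal past of the certified slab at `τ₁`, then — given the radius and truncated-
deviation clauses — `HasExhaustiveCharts d` holds with NOTHING required of the certified late
regions. [cite: DafermosLuk2017, Conjecture 1 (b)–(c)] -/
theorem hasExhaustiveCharts_of_subset_causalPast (d : FinalStateDecomposition 𝓢 O k)
    (R : Fin d.N → ℝ → ℝ)
    (hR : ∀ i, Tendsto (R i) atTop atTop ∧ ∀ τ, max (Kerr.rPlus (d.mass i) (d.spin i)) 0 + 1 ≤ R i τ)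
    (hdev : ∀ i, Tendsto (fun τ ↦ 𝓢.truncDeviationCk (d.background i) (d.chart i) k (R i τ) τ)
      atTop (𝓝 0))
    (hcof : ∀ τ₁ : ℝ, d.τ₀ < τ₁ →
      O ⊆ 𝓢.metric.causalPast 𝓢.timeOrientation (Summit.FinalStateConjecture.certifiedSlab d R τ₁)) :
    Summit.FinalStateConjecture.HasExhaustiveCharts d :=
  ⟨R, hR, hdev, fun τ₁ hτ ↦ sdiff_subset.trans (hcof τ₁ hτ)⟩

/-- The flat chart's image of any part of the flat slab `{x⁰ = τ₁} ∩ U₀` lies in the certified slab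
at `τ₁`, for any radii. [cite: DafermosLuk2017, Conjecture 1 (b)] -/
theorem image_subset_certifiedSlab (d : FinalStateDecomposition 𝓢 O k) (R : Fin d.N → ℝ → ℝ)
    {τ₁ : ℝ} {B : Set (Minkowski.backgroundOn d.flatDomain).domain}
    (hB : B ⊆ (Minkowski.backgroundOn d.flatDomain).timeSlab τ₁) :
    d.flatChart '' B ⊆ Summit.FinalStateConjecture.certifiedSlab d R τ₁ :=
  (image_mono hB).trans subset_union_left

/-- **Dust discharges clause (ii).** If at every chart time `τ₁ > τ₀` some part `B τ₁` of the flat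
slab `{x⁰ = τ₁} ∩ U₀` (in the intended reading: finitely or countably many small compact extra
components of `U₀` inside the excision tubes, `SoloInformedDust.lean`) is mapped by the flat chart
to a set whose causal past contains `O`, then clause (ii) holds for ANY radii, and
`HasExhaustiveCharts d` reduces to its radius and truncated-deviation clauses (i).
[cite: DafermosLuk2017, Conjecture 1 (b)–(c)] -/
theorem hasExhaustiveCharts_of_flat_subslab (d : FinalStateDecomposition 𝓢 O k)
    (R : Fin d.N → ℝ → ℝ)
    (hR : ∀ i, Tendsto (R i) atTop atTop ∧ ∀ τ, max (Kerr.rPlus (d.mass i) (d.spin i)) 0 + 1 ≤ R i τ)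
    (hdev : ∀ i, Tendsto (fun τ ↦ 𝓢.truncDeviationCk (d.background i) (d.chart i) k (R i τ) τ)
      atTop (𝓝 0))
    (B : ℝ → Set (Minkowski.backgroundOn d.flatDomain).domain)
    (hB : ∀ τ₁, d.τ₀ < τ₁ → B τ₁ ⊆ (Minkowski.backgroundOn d.flatDomain).timeSlab τ₁)
    (hcof : ∀ τ₁ : ℝ, d.τ₀ < τ₁ →
      O ⊆ 𝓢.metric.causalPast 𝓢.timeOrientation (d.flatChart '' B τ₁)) :
    Summit.FinalStateConjecture.HasExhaustiveCharts d :=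
  hasExhaustiveCharts_of_subset_causalPast d R hR hdev fun τ₁ hτ ↦
    (hcof τ₁ hτ).trans (LorentzianMetric.causalFuture_mono (τ := 𝓢.timeOrientation.reverse)
      (image_subset_certifiedSlab d R (hB τ₁ hτ)))

/-- **The dichotomy at one chart time, summarised.** Clause (ii) at `τ₁` is implied by cofinal reach
of the certified slab (`O ⊆ J⁻(certifiedSlab)`), and — for a causally non-decreasing `f` and a slab
in `{f ≤ T}` — implies that `O ∩ {f > T}` is certified-late. [folklore] -/
theorem clause_ii_dichotomy (d : FinalStateDecomposition 𝓢 O k) (R : Fin d.N → ℝ → ℝ) (τ₁ : ℝ)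
    (f : 𝓢.carrier → ℝ)
    (hmono : ∀ q p, p ∈ 𝓢.metric.causalPast 𝓢.timeOrientation {q} → f p ≤ f q) (T : ℝ) :
    (O ⊆ 𝓢.metric.causalPast 𝓢.timeOrientation (Summit.FinalStateConjecture.certifiedSlab d R τ₁) →
      O \ Summit.FinalStateConjecture.certifiedLate d R τ₁ ⊆
        𝓢.metric.causalPast 𝓢.timeOrientation (Summit.FinalStateConjecture.certifiedSlab d R τ₁)) ∧
    (O \ Summit.FinalStateConjecture.certifiedLate d R τ₁ ⊆
        𝓢.metric.causalPast 𝓢.timeOrientation (Summit.FinalStateConjecture.certifiedSlab d R τ₁) →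
      Summit.FinalStateConjecture.certifiedSlab d R τ₁ ⊆ {p | f p ≤ T} →
        O ∩ {p | T < f p} ⊆ Summit.FinalStateConjecture.certifiedLate d R τ₁) :=
  ⟨fun h ↦ sdiff_subset.trans h, fun hii hslab ↦ inter_subset_certifiedLate d R hii f hmono hslab⟩

end Reach

end Summit.FinalStateConjecture.FinalStateConjecture.Theorems
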